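import Literature.Topology.FourManifolds.BCSStablyParallelizable
import Literature.Topology.FourManifolds.SphereFamilySurgeryExistence
import HarnessLib

/-!
# Gluing stable framings over a spherical modification: `χ(W, φ)` is s-parallelizable once the
# tube framing and the handle framing match on the seam

Topic `Literature/Topology/FourManifolds` (fact seat of
`Literature.Topology.FourManifolds.HomotopySphere.boundsContractible_of_nullCobordism_isStablyParallelizable_four`;
the bundle-gluing half of Kervaire–Milnor's Lemma 5.4 / 6.2).  M. Kervaire, J. Milnor, *Groups of
homotopy spheres I*, Ann. of Math. 77 (1963), §6 p. 520 ("the modified manifold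
`M' = χ(M, φ)` automatically acquires a framing `f' = F|M'`") and A. Kosinski, *Differential
Manifolds* (1993), X, proof of Lemma (2.1), p. 200: a stable framing of `W ∖ S` and a stable
framing of the handle `OD^{k+1} × Sˡ` which AGREE along the seam glue to a stable framing of the
surgered manifold `χ(W, φ) = (W ∖ S) ∪_φ (OD^{k+1} × Sˡ)`.  This file isolates that elementary
gluing for the tree's construction `ν.Surgered hkl` (`SphereFamilySurgeryExistence.lean`), in the
style of `BCSStablyParallelizable.lean` (boundary connected sums):

* `SFrame d M` — a stable frame field datum on a manifold with boundary of dimension `d + 1`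
  (`d + 2` fields of `TM × ℝ`, continuous into `TM`, linearly independent); `SFrame.ofIsStablyParallelizable`,
  `SFrame.isStablyParallelizable`, restriction to an open submanifold `SFrame.restrict`;
* `SFrame.push` — push-forward along a smooth embedding with open range (continuity by
  `ContinuousOn.totalSpaceMk_mfderiv`, independence by the injectivity of the differential);
* `FramedSphereFamily.isStablyParallelizable_surgered_of_seam` — **the gluing theorem**: given a
  stable frame datum `FA` on `W ∖ S`, a stable frame datum `FH` on the handle, and the SEAM
  MATCHING condition — at every point `a = φ(u, ½v)` of the sphere bundle of radius `½`,
  `FH` at the glued point `glue a` is the image of `FA a` under the differential of the gluing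
  map — the surgered manifold `ν.Surgered hkl` is s-parallelizable (the frame pushed from `W ∖ S`
  on the compact piece `inl(W ∖ ½-tubes)`, the frame pushed from the handle on `inr(½-handle)`,
  pasted along the seam where they agree by the chain rule `inr ∘ glue = inl`).

Everything is proved; the `structure`/`def`s are explicit data; no named facts.

## References

* M. Kervaire, J. Milnor, *Groups of homotopy spheres I*, Ann. of Math. (2) 77 (1963), §6 p. 520,
  Lemmas 6.1–6.2. doi:10.2307/1970128 [KervaireMilnorAnnals1963]
* A. Kosinski, *Differential Manifolds* (1993), Ch. X §2, Lemma (2.1), p. 200. [Kosinski1993]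
* J. Milnor, J. Stasheff, *Characteristic Classes* (1974), §2–§3. [MilnorStasheff1974]
-/

noncomputable section

open scoped Manifold ContDiff Topology
open Set Function Bundle Metric

namespace Literature.Topology.FourManifolds

/-! ### Stable frame data on manifolds with boundary -/

/-- A **stable frame field datum** on a manifold `M` with boundary of dimension `d + 1`:
`d + 2` fields of vectors of `TM × ℝ`, continuous into `TM`, with continuous real parts, linearly
independent at every point (an unpacked witness of `IsStablyParallelizable (𝓡∂ (d + 1)) M`;
compare `NullCobordism.BCSSetup.StableFrame`). [folklore] -/
structure SFrame (d : ℕ) (M : Type*) [TopologicalSpace M] [ChartedSpace (EuclideanHalfSpace (d + 1)) M]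
    [IsManifold (𝓡∂ (d + 1)) 1 M] where
  /-- the vector fields -/
  s : Fin (d + 2) → M → EuclideanSpace ℝ (Fin (d + 1)) × ℝ
  cont : ∀ i, Continuous fun x => (TotalSpace.mk' (EuclideanSpace ℝ (Fin (d + 1))) x (s i x).1 :
    TangentBundle (𝓡∂ (d + 1)) M)
  cont₂ : ∀ i, Continuous fun x => (s i x).2
  linearIndependent : ∀ x, LinearIndependent ℝ fun i => s i x

namespace SFrame

variable {d : ℕ}

/-- `dim + 1 = d + 2`. [folklore] -/
theorem finrank_add_one (d : ℕ) : Module.finrank ℝ (EuclideanSpace ℝ (Fin (d + 1))) + 1 = d + 2 := by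
  rw [finrank_euclideanSpace_fin]

/-- An s-parallelizable manifold carries a stable frame field datum. [folklore] -/
theorem nonempty_of_isStablyParallelizable {M : Type*} [TopologicalSpace M]
    [ChartedSpace (EuclideanHalfSpace (d + 1)) M] [IsManifold (𝓡∂ (d + 1)) 1 M]
    (h : IsStablyParallelizable (𝓡∂ (d + 1)) M) : Nonempty (SFrame d M) := by
  obtain ⟨s, hs, hs₂, hli⟩ := h
  let e : Fin (d + 2) ≃ Fin (Module.finrank ℝ (EuclideanSpace ℝ (Fin (d + 1))) + 1) :=
    finCongr (finrank_add_one d).symm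
  exact ⟨⟨fun i => s (e i), fun i => hs (e i), fun i => hs₂ (e i), fun x => (hli x).comp e e.injective⟩⟩

/-- A stable frame field datum makes the manifold s-parallelizable. [folklore] -/
theorem isStablyParallelizable {M : Type*} [TopologicalSpace M]
    [ChartedSpace (EuclideanHalfSpace (d + 1)) M] [IsManifold (𝓡∂ (d + 1)) 1 M] (F : SFrame d M) :
    IsStablyParallelizable (𝓡∂ (d + 1)) M := by
  let e : Fin (Module.finrank ℝ (EuclideanSpace ℝ (Fin (d + 1))) + 1) ≃ Fin (d + 2) :=
    finCongr (finrank_add_one d)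
  exact ⟨fun i => F.s (e i), fun i => F.cont (e i), fun i => F.cont₂ (e i),
    fun x => (F.linearIndependent x).comp e e.injective⟩

/-- **Restriction of a stable frame field datum to an open submanifold** (`T U = T M|_U`).
[cite: MilnorStasheff1974, §2] -/
def restrict {M : Type*} [TopologicalSpace M] [ChartedSpace (EuclideanHalfSpace (d + 1)) M]
    [IsManifold (𝓡∂ (d + 1)) 1 M] (F : SFrame d M) (U : TopologicalSpace.Opens M) : SFrame d ↥U where
  s i a := F.s i a.1
  cont i := by
    have h : ContinuousOn (fun a : ↥U => (TotalSpace.mk' (EuclideanSpace ℝ (Fin (d + 1))) a (F.s i a.1).1 :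
        TangentBundle (𝓡∂ (d + 1)) ↥U)) univ := by
      rw [continuousOn_totalSpaceMk_opens_iff (I := 𝓡∂ (d + 1)) U (f := fun a : ↥U => a)
        continuousOn_id]
      exact ((F.cont i).comp continuous_subtype_val).continuousOn
    exact continuousOn_univ.1 h
  cont₂ i := (F.cont₂ i).comp continuous_subtype_val
  linearIndependent a := F.linearIndependent a.1

/-- Unfolding lemma for the restriction. [folklore] -/
@[simp] theorem restrict_s {M : Type*} [TopologicalSpace M] [ChartedSpace (EuclideanHalfSpace (d + 1)) M]
    [IsManifold (𝓡∂ (d + 1)) 1 M] (F : SFrame d M) (U : TopologicalSpace.Opens M) (i : Fin (d + 2)) (a : ↥U) :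
    (F.restrict U).s i a = F.s i a.1 := rfl

/-! ### Push-forward along a smooth embedding with open range -/

section Push

variable {M : Type*} [TopologicalSpace M] [ChartedSpace (EuclideanHalfSpace (d + 1)) M]
  [IsManifold (𝓡∂ (d + 1)) ∞ M]
  {P : Type*} [TopologicalSpace P] [ChartedSpace (EuclideanHalfSpace (d + 1)) P]
  [IsManifold (𝓡∂ (d + 1)) ∞ P]
  (ι : M → P) (hι : Manifold.IsSmoothEmbedding (𝓡∂ (d + 1)) (𝓡∂ (d + 1)) ∞ ι)
  (hιo : IsOpen (range ι)) (F : SFrame d M)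

/-- **Push-forward of a stable frame field along a smooth map**: at `a`, the vectors
`(dι_a (sᵢ a), tᵢ a)`. [cite: MilnorStasheff1974, §2] -/
def pushVec (a : M) (i : Fin (d + 2)) : EuclideanSpace ℝ (Fin (d + 1)) × ℝ :=
  (mfderiv (𝓡∂ (d + 1)) (𝓡∂ (d + 1)) ι a (F.s i a).1, (F.s i a).2)

include hι in
/-- The pushed frame field is continuous into `TP` along `ι`. [cite: MilnorStasheff1974, §2] -/
theorem continuous_pushVec (i : Fin (d + 2)) :
    Continuous fun a : M => (TotalSpace.mk' (EuclideanSpace ℝ (Fin (d + 1))) (ι a) (pushVec ι F a i).1 :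
      TangentBundle (𝓡∂ (d + 1)) P) := by
  have h2 := ContinuousOn.totalSpaceMk_mfderiv (I := 𝓡∂ (d + 1)) (J := 𝓡∂ (d + 1)) (f := ι)
    isOpen_univ (hι.contMDiff.of_le (by exact_mod_cast le_top)).contMDiffOn (g := fun a : M => a)
    (v := fun a : M => (F.s i a).1) (t := univ) (F.cont i).continuousOn (mapsTo_univ _ _)
  exact continuousOn_univ.1 h2

omit [IsManifold (𝓡∂ (d + 1)) ∞ P] in
include hι hιo in
/-- The pushed frame is linearly independent at every point (`dι_a` is injective).
[cite: MilnorStasheff1974, §2] -/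
theorem linearIndependent_pushVec (a : M) : LinearIndependent ℝ (pushVec ι F a) := by
  set D : EuclideanSpace ℝ (Fin (d + 1)) →L[ℝ] EuclideanSpace ℝ (Fin (d + 1)) :=
    mfderiv (𝓡∂ (d + 1)) (𝓡∂ (d + 1)) ι a with hD
  have hdet : LinearMap.det (D : EuclideanSpace ℝ (Fin (d + 1)) →ₗ[ℝ] EuclideanSpace ℝ (Fin (d + 1))) ≠ 0 :=
    det_mfderiv_ne_zero_of_isSmoothEmbedding hι hιo a
  have hinj : Injective D := by
    have hk : LinearMap.ker (D : EuclideanSpace ℝ (Fin (d + 1)) →ₗ[ℝ] EuclideanSpace ℝ (Fin (d + 1))) = ⊥ := by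
      by_contra hk
      exact hdet ((LinearMap.det_eq_zero_iff_ker_ne_bot
        (f := (D : EuclideanSpace ℝ (Fin (d + 1)) →ₗ[ℝ] EuclideanSpace ℝ (Fin (d + 1))))).mpr hk)
    exact LinearMap.ker_eq_bot.1 hk
  have hker : LinearMap.ker (D.toLinearMap.prodMap (LinearMap.id : ℝ →ₗ[ℝ] ℝ)) = ⊥ := by
    rw [LinearMap.ker_eq_bot]
    rintro ⟨v, r⟩ ⟨v', r'⟩ hvr
    have h1 : D v = D v' := congrArg Prod.fst hvr
    have h2 : r = r' := congrArg Prod.snd hvr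
    exact Prod.ext (hinj h1) h2
  have h : pushVec ι F a = (D.toLinearMap.prodMap (LinearMap.id : ℝ →ₗ[ℝ] ℝ)) ∘ fun i => F.s i a := by
    funext i
    rfl
  rw [h]
  exact (F.linearIndependent a).map' _ hker

variable [Nonempty M]

/-- The pushed frame field, as a field on the open piece `range ι ⊆ P` (through the inverse of
the embedding). [cite: MilnorStasheff1974, §2] -/
def push (p : P) (i : Fin (d + 2)) : EuclideanSpace ℝ (Fin (d + 1)) × ℝ :=
  pushVec ι F ((openEmbeddingChart hι hιo).symm p) i

omit [IsManifold (𝓡∂ (d + 1)) ∞ P] in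
/-- On the image of `a` the pushed field is the pushed vector at `a`. [folklore] -/
theorem push_apply (a : M) (i : Fin (d + 2)) : push ι hι hιo F (ι a) i = pushVec ι F a i := by
  rw [push, openEmbeddingChart_symm_apply]

/-- The pushed field is continuous into `TP` on `range ι`. [cite: MilnorStasheff1974, §2] -/
theorem continuousOn_push (i : Fin (d + 2)) :
    ContinuousOn (fun p => (TotalSpace.mk' (EuclideanSpace ℝ (Fin (d + 1))) p (push ι hι hιo F p i).1 :
      TangentBundle (𝓡∂ (d + 1)) P)) (range ι) := by
  have h1 := (continuous_pushVec ι hι F i).comp_continuousOn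
    ((openEmbeddingChart hι hιo).continuousOn_symm.mono (by rw [openEmbeddingChart_target]))
  refine h1.congr fun p hp => ?_
  have hp' : p ∈ (openEmbeddingChart hι hιo).target := by rw [openEmbeddingChart_target]; exact hp
  change (TotalSpace.mk' _ p _ : TangentBundle (𝓡∂ (d + 1)) P) =
    TotalSpace.mk' _ (ι ((openEmbeddingChart hι hιo).symm p)) _
  congr 1
  exact ((openEmbeddingChart hι hιo).right_inv hp').symm

omit [IsManifold (𝓡∂ (d + 1)) ∞ P] in
/-- The real parts of the pushed field are continuous on `range ι`. [folklore] -/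
theorem continuousOn_push_snd (i : Fin (d + 2)) :
    ContinuousOn (fun p => (push ι hι hιo F p i).2) (range ι) :=
  (F.cont₂ i).comp_continuousOn
    ((openEmbeddingChart hι hιo).continuousOn_symm.mono (by rw [openEmbeddingChart_target]))

omit [IsManifold (𝓡∂ (d + 1)) ∞ P] in
/-- The pushed field is a frame at every point. [folklore] -/
theorem linearIndependent_push (p : P) : LinearIndependent ℝ (push ι hι hιo F p) :=
  linearIndependent_pushVec ι hι hιo F _

end Push

end SFrame

/-! ### Gluing over a spherical modification -/

namespace FramedSphereFamily

universe u

variable {n k l : ℕ} {X : Type u} [TopologicalSpace X] [T2Space X] [CompactSpace X]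
  [ChartedSpace (EuclideanHalfSpace (n + 1)) X] [IsManifold (𝓡∂ (n + 1)) ∞ X]
  {ι : Type u} [Unique ι]
  (ν : FramedSphereFamily (𝓡∂ (n + 1)) X ι k (l + 1)) (hkl : k + l = n)

attribute [local instance] fact_finrank_euclideanSpace_succ

/-- The point `φ(u, ½v)` of the seam sphere bundle, in `X ∖ cores`. [folklore] -/
def seamPt (u : Metric.sphere (0 : EuclideanSpace ℝ (Fin (k + 1))) 1)
    (v : Metric.sphere (0 : EuclideanSpace ℝ (Fin (l + 1))) 1) : ↥ν.complement :=
  ⟨ν.toFun default (u, (2⁻¹ : ℝ) • (v : EuclideanSpace ℝ (Fin (l + 1)))),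
    ν.apply_mem_complement default u (by
      intro h
      have : ‖(2⁻¹ : ℝ) • (v : EuclideanSpace ℝ (Fin (l + 1)))‖ = 2⁻¹ := by
        rw [norm_smul, norm_eq_of_mem_sphere, mul_one]; norm_num
      rw [h, norm_zero] at this
      norm_num at this)⟩

omit [CompactSpace X] [IsManifold (𝓡∂ (n + 1)) ∞ X] in
/-- The underlying point of `seamPt`. [folklore] -/
@[simp] theorem coe_seamPt (u : Metric.sphere (0 : EuclideanSpace ℝ (Fin (k + 1))) 1)
    (v : Metric.sphere (0 : EuclideanSpace ℝ (Fin (l + 1))) 1) :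
    (ν.seamPt u v : X) = ν.toFun default (u, (2⁻¹ : ℝ) • (v : EuclideanSpace ℝ (Fin (l + 1)))) := rfl

omit [CompactSpace X] [IsManifold (𝓡∂ (n + 1)) ∞ X] in
/-- Seam points lie in the gluing region. [folklore] -/
theorem seamPt_mem_source (u : Metric.sphere (0 : EuclideanSpace ℝ (Fin (k + 1))) 1)
    (v : Metric.sphere (0 : EuclideanSpace ℝ (Fin (l + 1))) 1) :
    ν.seamPt u v ∈ (ν.glue hkl).source := by
  rw [glue_source, mem_setOf_eq, coe_seamPt, apply_mem_puncturedTubes_iff]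
  have hn : ‖(2⁻¹ : ℝ) • (v : EuclideanSpace ℝ (Fin (l + 1)))‖ = 2⁻¹ := by
    rw [norm_smul, norm_eq_of_mem_sphere, mul_one]; norm_num
  refine ⟨fun h => ?_, by rw [hn]; norm_num⟩
  have h' : (2⁻¹ : ℝ) • (v : EuclideanSpace ℝ (Fin (l + 1))) = 0 := h
  rw [h', norm_zero] at hn
  norm_num at hn

set_option maxHeartbeats 800000 in
/-- **The gluing theorem: `χ(W, φ)` is s-parallelizable once the tube framing and the handle
framing match on the seam** (Kervaire–Milnor 1963, §6 p. 520; Kosinski 1993, X (2.1)).  Let `FA`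
be a stable frame field datum on `W ∖ S` and `FH` one on the handle `OD^{k+1} × Sˡ`, such that
at every seam point `a = φ(u, ½v)` the handle frame at the glued point is the image of the frame
of `W ∖ S` under the differential of the gluing map.  Then the surgered manifold is
s-parallelizable: the frames pushed along the two gluing embeddings agree on the seam (chain
rule, `inr ∘ glue = inl` near the seam) and paste along the closed cover
`inl(W ∖ ½-tubes) ∪ inr(½-handle)`. [cite: KervaireMilnorAnnals1963, §6 p. 520] -/
theorem isStablyParallelizable_surgered_of_seam
    (FA : SFrame n ↥ν.complement) (FH : SFrame n (SphereSurgery.Handle ι k l hkl))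
    (hmatch : ∀ (u : Metric.sphere (0 : EuclideanSpace ℝ (Fin (k + 1))) 1)
      (v : Metric.sphere (0 : EuclideanSpace ℝ (Fin (l + 1))) 1) (i : Fin (n + 2)),
      FH.s i (ν.glue hkl (ν.seamPt u v)) =
        (mfderiv (𝓡∂ (n + 1)) (𝓡∂ (n + 1)) (ν.glue hkl) (ν.seamPt u v) (FA.s i (ν.seamPt u v)).1,
          (FA.s i (ν.seamPt u v)).2)) :
    IsStablyParallelizable (𝓡∂ (n + 1)) (ν.Surgered hkl) := by
  classical
  -- ### the two gluing embeddings
  have hA : Manifold.IsSmoothEmbedding (𝓡∂ (n + 1)) (𝓡∂ (n + 1)) ∞ (ν.glueData hkl).inl := (ν.glueData hkl).isSmoothEmbedding_inlH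
  have hAo : IsOpen (range (ν.glueData hkl).inl) := (ν.glueData hkl).isOpen_range_inl
  have hB : Manifold.IsSmoothEmbedding (𝓡∂ (n + 1)) (𝓡∂ (n + 1)) ∞ (ν.glueData hkl).inr := (ν.glueData hkl).isSmoothEmbedding_inrH
  have hBo : IsOpen (range (ν.glueData hkl).inr) := (ν.glueData hkl).isOpen_range_inr
  haveI : Nonempty ↥ν.complement := ⟨ν.seamPt (Classical.arbitrary _) (Classical.arbitrary _)⟩
  haveI : Nonempty (SphereSurgery.Handle ι k l hkl) := ⟨ν.glue hkl (Classical.arbitrary _)⟩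
  -- ### the two pushed frame fields
  set fr₁ := SFrame.push (ν.glueData hkl).inl hA hAo FA with hfr₁
  set fr₂ := SFrame.push (ν.glueData hkl).inr hB hBo FH with hfr₂
  -- ### the closed cover
  set C : Set (ν.Surgered hkl) := (ν.glueData hkl).inl '' ν.cptA with hC
  set D : Set (ν.Surgered hkl) := (ν.glueData hkl).inr '' SphereSurgery.handleCpt (ι := ι) hkl with hD
  have hCc : IsClosed C := (ν.isCompact_cptA.image (ν.glueData hkl).continuous_inl).isClosed
  have hDc : IsClosed D := ((SphereSurgery.isCompact_handleCpt hkl).image (ν.glueData hkl).continuous_inr).isClosed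
  have hcov : C ∪ D = univ := by
    refine eq_univ_of_forall fun p => ?_
    rcases (ν.glueData hkl).exists_inl_or_inr p with ⟨a, rfl⟩ | ⟨b, rfl⟩
    · by_cases ha : a ∈ ν.cptA
      · exact Or.inl ⟨a, ha, rfl⟩
      · obtain ⟨hsrc, hcpt⟩ := ν.forall_not_mem_cptA hkl a ha
        exact Or.inr ⟨_, hcpt, (ν.glueData hkl).inr_glue hsrc⟩
    · by_cases hb : b ∈ SphereSurgery.handleCpt (ι := ι) hkl
      · exact Or.inr ⟨b, hb, rfl⟩
      · obtain ⟨htgt, hcpt⟩ := ν.forall_not_mem_cptB hkl b hb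
        exact Or.inl ⟨_, hcpt, (ν.glueData hkl).inl_glue_symm htgt⟩
  have hCsub : C ⊆ range (ν.glueData hkl).inl := by
    rintro p ⟨a, -, rfl⟩; exact mem_range_self a
  have hDsub : D ⊆ range (ν.glueData hkl).inr := by
    rintro p ⟨b, -, rfl⟩; exact mem_range_self b
  -- ### on `C ∩ D` the two frames agree
  have hagree : ∀ p ∈ C ∩ D, ∀ i, fr₁ p i = fr₂ p i := by
    rintro p ⟨⟨a, ha, rfl⟩, ⟨b, hb, hab⟩⟩ i
    -- `a = φ(u, w)` with `‖w‖ = ½`: a seam point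
    have hrel : a ∈ (ν.glue hkl).source ∧ ν.glue hkl a = b :=
      ((ν.glueData hkl).inl_eq_inr_iff (a := a) (b := b)).1 hab.symm
    obtain ⟨hsrc, hgab⟩ := hrel
    obtain ⟨j, q, hq0, hq1, hqa⟩ := ν.mem_puncturedTubes_iff.1 (by simpa [glue_source] using hsrc)
    obtain rfl : j = default := Subsingleton.elim _ _
    -- the norm of the fibre coordinate is `½`
    have hle : 2⁻¹ ≤ ‖q.2‖ := by
      by_contra hlt
      push Not at hlt
      have ha' : (a : X) ∉ ν.halfTubes := ha
      exact ha' (mem_iUnion.2 ⟨default, q, hlt, hqa⟩)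
    have hge : ‖q.2‖ ≤ 2⁻¹ := by
      obtain ⟨b', hb', hb'b⟩ := hb
      have h1 : ν.glue hkl a = SphereSurgery.toHandle ι k l hkl b' := by rw [hgab, ← hb'b]
      rw [glue_apply] at h1
      have h2 : ν.fwdB a = b' := (SphereSurgery.bijective_toHandle hkl).1 h1
      have h3 : ((ν.fwdB (a : X) : ↥(ballTimesSphere ι k l)) :
          DiscreteIndex ι × ((EuclideanSpace ℝ (Fin (k + 1))) ×
            (Metric.sphere (0 : EuclideanSpace ℝ (Fin (l + 1))) 1))) =
          (DiscreteIndex.mk default, SphereSurgery.polar q) := by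
        rw [← hqa]
        exact ν.coe_fwdB_apply (i := default) (q := q) hq1
      have h4 : ‖((b' : DiscreteIndex ι × ((EuclideanSpace ℝ (Fin (k + 1))) ×
          (Metric.sphere (0 : EuclideanSpace ℝ (Fin (l + 1))) 1)))).2.1‖ ≤ 2⁻¹ := hb'
      rw [← h2, h3] at h4
      simpa [SphereSurgery.norm_polar_fst] using h4
    have hnorm : ‖q.2‖ = 2⁻¹ := le_antisymm hge hle
    -- write `a` as a seam point
    set vv : Metric.sphere (0 : EuclideanSpace ℝ (Fin (l + 1))) 1 :=
      radialProjection (spherePt l) q.2 with hvv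
    have hqw : q.2 = (2⁻¹ : ℝ) • (vv : EuclideanSpace ℝ (Fin (l + 1))) := by
      rw [hvv, ← hnorm, norm_smul_coe_radialProjection]
    have haseam : a = ν.seamPt q.1 vv := by
      apply Subtype.ext
      rw [coe_seamPt, ← hqw, ← hqa]
    subst haseam
    -- the two pushed vectors at `p = inl a = inr (glue a)`
    have e1 : fr₁ ((ν.glueData hkl).inl (ν.seamPt q.1 vv)) i = SFrame.pushVec (ν.glueData hkl).inl FA (ν.seamPt q.1 vv) i :=
      SFrame.push_apply _ hA hAo FA _ i
    have e2 : fr₂ ((ν.glueData hkl).inl (ν.seamPt q.1 vv)) i = SFrame.pushVec (ν.glueData hkl).inr FH (ν.glue hkl (ν.seamPt q.1 vv)) i := by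
      rw [← (ν.glueData hkl).inr_glue hsrc]
      exact SFrame.push_apply _ hB hBo FH _ i
    rw [e1, e2]
    simp only [SFrame.pushVec]
    rw [hmatch q.1 vv i]
    refine Prod.ext ?_ rfl
    -- chain rule: `d(inr)_{glue a} ∘ d(glue)_a = d(inl)_a`
    have hsrc' : ν.seamPt q.1 vv ∈ (ν.glue hkl).source := hsrc
    have hglue : MDifferentiableAt (𝓡∂ (n + 1)) (𝓡∂ (n + 1)) (ν.glue hkl) (ν.seamPt q.1 vv) :=
      ((ν.contMDiffOn_glue hkl).contMDiffAt ((ν.glue hkl).open_source.mem_nhds hsrc')).mdifferentiableAt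
        (by simp)
    have hinr : MDifferentiableAt (𝓡∂ (n + 1)) (𝓡∂ (n + 1)) (ν.glueData hkl).inr (ν.glue hkl (ν.seamPt q.1 vv)) :=
      (hB.contMDiff _).mdifferentiableAt (by simp)
    have hcomp := mfderiv_comp (ν.seamPt q.1 vv) hinr hglue
    have hev : (ν.glueData hkl).inl =ᶠ[𝓝 (ν.seamPt q.1 vv)] ((ν.glueData hkl).inr ∘ ν.glue hkl) := by
      filter_upwards [(ν.glue hkl).open_source.mem_nhds hsrc'] with a' ha'
      exact ((ν.glueData hkl).inr_glue ha').symm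
    have key := hev.mfderiv_eq.trans hcomp
    dsimp only
    rw [key]
    rfl
  -- ### the glued frame
  let G : ν.Surgered hkl → Fin (n + 2) → EuclideanSpace ℝ (Fin (n + 1)) × ℝ :=
    fun p i => if p ∈ C then fr₁ p i else fr₂ p i
  have hGC : ∀ p ∈ C, ∀ i, G p i = fr₁ p i := fun p hp i => by simp [G, hp]
  have hGD : ∀ p ∈ D, ∀ i, G p i = fr₂ p i := fun p hp i => by
    by_cases hpC : p ∈ C
    · simp only [G, hpC, if_true]
      exact hagree p ⟨hpC, hp⟩ i
    · simp [G, hpC]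
  refine SFrame.isStablyParallelizable
    { s := fun i p => G p i
      cont := fun i => ?_
      cont₂ := fun i => ?_
      linearIndependent := fun p => ?_ }
  · rw [← continuousOn_univ, ← hcov]
    refine ContinuousOn.union_of_isClosed ?_ ?_ hCc hDc
    · refine ((SFrame.continuousOn_push (ν.glueData hkl).inl hA hAo FA i).mono hCsub).congr fun p hp => ?_
      change (TotalSpace.mk' _ p _ : TangentBundle (𝓡∂ (n + 1)) (ν.Surgered hkl)) = TotalSpace.mk' _ p _
      rw [hGC p hp i]
    · refine ((SFrame.continuousOn_push (ν.glueData hkl).inr hB hBo FH i).mono hDsub).congr fun p hp => ?_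
      change (TotalSpace.mk' _ p _ : TangentBundle (𝓡∂ (n + 1)) (ν.Surgered hkl)) = TotalSpace.mk' _ p _
      rw [hGD p hp i]
  · rw [← continuousOn_univ, ← hcov]
    refine ContinuousOn.union_of_isClosed ?_ ?_ hCc hDc
    · exact ((SFrame.continuousOn_push_snd (ν.glueData hkl).inl hA hAo FA i).mono hCsub).congr fun p hp => by
        rw [hGC p hp i]
    · exact ((SFrame.continuousOn_push_snd (ν.glueData hkl).inr hB hBo FH i).mono hDsub).congr fun p hp => by
        rw [hGD p hp i]
  · by_cases hp : p ∈ C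
    · have h : (fun i => G p i) = fr₁ p := funext fun i => hGC p hp i
      rw [h]
      exact SFrame.linearIndependent_push (ν.glueData hkl).inl hA hAo FA p
    · have hpD : p ∈ D := ((hcov.symm ▸ mem_univ p : p ∈ C ∪ D)).resolve_left hp
      have h : (fun i => G p i) = fr₂ p := funext fun i => hGD p hpD i
      rw [h]
      exact SFrame.linearIndependent_push (ν.glueData hkl).inr hB hBo FH p

end FramedSphereFamily

end Literature.Topology.FourManifolds

end
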